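import Mathlib.Analysis.VonNeumannAlgebra.Basic
import Mathlib.Analysis.InnerProductSpace.Dual
import Mathlib.Analysis.CStarAlgebra.ContinuousFunctionalCalculus.Commute
import Mathlib.Analysis.CStarAlgebra.ContinuousFunctionalCalculus.Basic
import Mathlib.Analysis.CStarAlgebra.ContinuousLinearMap
import HarnessLib

/-!
# Weak-operator limits and functional calculus inside a von Neumann algebra

Elementary closure properties of a von Neumann algebra `M ⊆ B(H)` (von Neumann's double
commutant theorem is the definition of `VonNeumannAlgebra` in Mathlib, so everything below is a
short consequence of `M = M''`):

* `VonNeumannAlgebra.cfc_real_mem`, `cfc_mem` — `M` is closed under the continuous functional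
  calculus of its self-adjoint / normal elements (Bratteli–Robinson Lemma 2.5.8 in the bounded
  form: functions of elements of `M` lie in `M`).
* `VonNeumannAlgebra.mem_of_weak_tendsto` — weak-operator limits (along any nontrivial filter) of
  elements of `M` lie in `M`.
* `ultraWOTLim` — the weak-operator limit of a bounded family of operators along an
  **ultrafilter**, constructed from the Riesz representation theorem and compactness of closed
  discs in `ℂ` (a replacement, sufficient for Rieffel–van Daele's use of Sakai's Radon–Nikodym
  argument in Lemma 4.3 of *A bounded operator approach to Tomita–Takesaki theory*, for the
  weak-operator compactness of the unit ball of `B(H)`): `⟪φ, (ultraWOTLim 𝒰 x c hx) ψ⟫` is the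
  `𝒰`-limit of `⟪φ, xₙ ψ⟫`; the limit stays in `M`, stays self-adjoint, and has norm `≤ c`.

## References
* O. Bratteli, D. W. Robinson, *Operator Algebras and Quantum Statistical Mechanics 1*, 2nd ed.,
  Lemma 2.5.8 and §2.4.2 (von Neumann density / bicommutant theorem). [BratteliRobinsonI1987]
* M. A. Rieffel, A. van Daele, *A bounded operator approach to Tomita–Takesaki theory*, Pacific
  J. Math. 69 (1977), Lemma 4.3 (proof: "`V` is weakly compact"). [RieffelVandaele1977]
-/

noncomputable section

open Filter ContinuousLinearMap
open _root_.Topology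
open scoped InnerProductSpace ComplexConjugate

set_option synthInstance.maxHeartbeats 200000

namespace Literature.Analysis.OperatorTheory

variable {H : Type*} [NormedAddCommGroup H] [InnerProductSpace ℂ H] [CompleteSpace H]

/-! ### Membership via the commutant -/

/-- `X ∈ M` iff `X` commutes with every element of `M'` (double commutant). [cite: BratteliRobinsonI1987, §2.4.2 (bicommutant theorem)] -/
theorem VonNeumannAlgebra.mem_iff_forall_commute (M : VonNeumannAlgebra H) (X : H →L[ℂ] H) :
    X ∈ M ↔ ∀ Y ∈ M.commutant, X * Y = Y * X := by
  conv_lhs => rw [← VonNeumannAlgebra.commutant_commutant M]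
  rw [VonNeumannAlgebra.mem_commutant_iff]
  exact ⟨fun h Y hY => (h Y hY).symm, fun h Y hY => (h Y hY).symm⟩

/-- **Functions of self-adjoint elements of `M` lie in `M`** (real continuous functional
calculus). [cite: BratteliRobinsonI1987, Lemma 2.5.8] -/
theorem VonNeumannAlgebra.cfc_real_mem (M : VonNeumannAlgebra H) {A : H →L[ℂ] H} (hA : A ∈ M)
    (g : ℝ → ℝ) : cfc g A ∈ M := by
  rw [VonNeumannAlgebra.mem_iff_forall_commute]
  intro Y hY
  have hc : Commute A Y := ((VonNeumannAlgebra.mem_iff_forall_commute M A).1 hA Y hY)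
  exact (hc.cfc_real g).eq

/-- **Functions of normal elements of `M` lie in `M`** (complex continuous functional calculus;
`M` is star-closed so `Y ∈ M'` commutes with `A` and `A*`). [cite: BratteliRobinsonI1987, Lemma 2.5.8] -/
theorem VonNeumannAlgebra.cfc_mem (M : VonNeumannAlgebra H) {A : H →L[ℂ] H} (hA : A ∈ M)
    (g : ℂ → ℂ) : cfc g A ∈ M := by
  rw [VonNeumannAlgebra.mem_iff_forall_commute]
  intro Y hY
  have hc : Commute A Y := ((VonNeumannAlgebra.mem_iff_forall_commute M A).1 hA Y hY)
  have hc' : Commute (star A) Y :=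
    ((VonNeumannAlgebra.mem_iff_forall_commute M (star A)).1 (star_mem hA) Y hY)
  exact (hc.cfc hc' g).eq

/-- **Weak-operator limits stay in `M`**: if `xᵢ ∈ M` and `⟪φ, xᵢ ψ⟫ → ⟪φ, X ψ⟫` along a nontrivial
filter for all `φ, ψ`, then `X ∈ M`. [cite: BratteliRobinsonI1987, §2.4.2 (bicommutant theorem)] -/
theorem VonNeumannAlgebra.mem_of_weak_tendsto (M : VonNeumannAlgebra H) {ι : Type*} {l : Filter ι}
    [l.NeBot] {x : ι → H →L[ℂ] H} (hx : ∀ i, x i ∈ M) {X : H →L[ℂ] H}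
    (hlim : ∀ φ ψ : H, Tendsto (fun i => ⟪φ, x i ψ⟫_ℂ) l (𝓝 ⟪φ, X ψ⟫_ℂ)) : X ∈ M := by
  rw [VonNeumannAlgebra.mem_iff_forall_commute]
  intro Y hY
  refine ContinuousLinearMap.ext fun ψ => ext_inner_left ℂ fun φ => ?_
  rw [mul_apply_eq_comp, mul_apply_eq_comp]
  -- `⟪φ, X (Y ψ)⟫ = lim ⟪φ, xᵢ (Y ψ)⟫ = lim ⟪φ, Y (xᵢ ψ)⟫ = lim ⟪Y† φ, xᵢ ψ⟫ = ⟪Y† φ, X ψ⟫`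
  have h1 := hlim φ (Y ψ)
  have h2 := hlim (ContinuousLinearMap.adjoint Y φ) ψ
  have heq : (fun i => ⟪φ, x i (Y ψ)⟫_ℂ) = fun i => ⟪ContinuousLinearMap.adjoint Y φ, x i ψ⟫_ℂ := by
    ext i
    have hc := (VonNeumannAlgebra.mem_iff_forall_commute M (x i)).1 (hx i) Y hY
    rw [ContinuousLinearMap.adjoint_inner_left, ← mul_apply_eq_comp, hc, mul_apply_eq_comp]
  rw [heq] at h1
  have := tendsto_nhds_unique h1 h2
  rw [this, ContinuousLinearMap.adjoint_inner_left]

/-- **Strong-operator limits stay in `M`**. [cite: BratteliRobinsonI1987, §2.4.2 (bicommutant theorem)] -/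
theorem VonNeumannAlgebra.mem_of_strong_tendsto (M : VonNeumannAlgebra H) {ι : Type*}
    {l : Filter ι} [l.NeBot] {x : ι → H →L[ℂ] H} (hx : ∀ i, x i ∈ M) {X : H →L[ℂ] H}
    (hlim : ∀ ψ : H, Tendsto (fun i => x i ψ) l (𝓝 (X ψ))) : X ∈ M :=
  VonNeumannAlgebra.mem_of_weak_tendsto M hx fun _ ψ =>
    ((continuous_const.inner continuous_id).tendsto _).comp (hlim ψ)

/-! ### Weak-operator limits along ultrafilters -/

section Ultra

/-- A bounded family of complex numbers converges along an ultrafilter. [folklore] -/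
theorem exists_tendsto_of_norm_le {ι : Type*} (𝒰 : Ultrafilter ι) {a : ι → ℂ} {R : ℝ}
    (ha : ∀ i, ‖a i‖ ≤ R) : ∃ z : ℂ, Tendsto a 𝒰 (𝓝 z) := by
  have hmem : Metric.closedBall (0 : ℂ) R ∈ (𝒰.map a) := by
    apply Ultrafilter.mem_map.2
    filter_upwards with i
    simpa using ha i
  obtain ⟨z, -, hz⟩ := (isCompact_closedBall (0 : ℂ) R).ultrafilter_le_nhds' (𝒰.map a) hmem
  exact ⟨z, hz⟩

omit [CompleteSpace H] in
/-- `0 ≤ c` from the bound (an ultrafilter lives on a nonempty type). [folklore] -/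
theorem nonneg_of_norm_bound {ι : Type*} (𝒰 : Ultrafilter ι) {x : ι → H →L[ℂ] H} {c : ℝ}
    (hx : ∀ i, ‖x i‖ ≤ c) : 0 ≤ c := by
  obtain ⟨i⟩ := Filter.nonempty_of_neBot (𝒰 : Filter ι)
  exact le_trans (norm_nonneg _) (hx i)

variable {ι : Type*} (𝒰 : Ultrafilter ι) (x : ι → H →L[ℂ] H) (c : ℝ) (hx : ∀ i, ‖x i‖ ≤ c)

omit [CompleteSpace H] in
include hx in
/-- The matrix elements `⟪φ, xᵢ ψ⟫` converge along `𝒰`. [folklore] -/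
theorem exists_tendsto_inner (φ ψ : H) : ∃ z : ℂ, Tendsto (fun i => ⟪φ, x i ψ⟫_ℂ) 𝒰 (𝓝 z) := by
  refine exists_tendsto_of_norm_le 𝒰 (R := ‖φ‖ * (c * ‖ψ‖)) fun i => ?_
  calc ‖⟪φ, x i ψ⟫_ℂ‖ ≤ ‖φ‖ * ‖x i ψ‖ := norm_inner_le_norm _ _
    _ ≤ ‖φ‖ * (c * ‖ψ‖) := by
        gcongr
        exact (le_opNorm _ _).trans (by gcongr; exact hx i)

/-- The `𝒰`-limit of the matrix elements, as a function of `φ, ψ`. [folklore] -/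
def wotLimForm (φ ψ : H) : ℂ := limUnder (𝒰 : Filter ι) fun i => ⟪φ, x i ψ⟫_ℂ

omit [CompleteSpace H] in
include hx in
/-- Defining property of `wotLimForm`. [folklore] -/
theorem tendsto_wotLimForm (φ ψ : H) :
    Tendsto (fun i => ⟪φ, x i ψ⟫_ℂ) 𝒰 (𝓝 (wotLimForm 𝒰 x φ ψ)) := by
  obtain ⟨z, hz⟩ := exists_tendsto_inner 𝒰 x c hx φ ψ
  rw [wotLimForm, hz.limUnder_eq]
  exact hz

omit [CompleteSpace H] in
include hx in
/-- `wotLimForm` is additive in `ψ`. [folklore] -/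
theorem wotLimForm_add_right (φ ψ₁ ψ₂ : H) :
    wotLimForm 𝒰 x φ (ψ₁ + ψ₂) = wotLimForm 𝒰 x φ ψ₁ + wotLimForm 𝒰 x φ ψ₂ := by
  have h := (tendsto_wotLimForm 𝒰 x c hx φ ψ₁).add (tendsto_wotLimForm 𝒰 x c hx φ ψ₂)
  have h' := tendsto_wotLimForm 𝒰 x c hx φ (ψ₁ + ψ₂)
  simp only [map_add, inner_add_right] at h'
  exact tendsto_nhds_unique h' h

omit [CompleteSpace H] in
include hx in
/-- `wotLimForm` is homogeneous in `ψ`. [folklore] -/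
theorem wotLimForm_smul_right (φ : H) (a : ℂ) (ψ : H) :
    wotLimForm 𝒰 x φ (a • ψ) = a * wotLimForm 𝒰 x φ ψ := by
  have h := (tendsto_wotLimForm 𝒰 x c hx φ ψ).const_mul a
  have h' := tendsto_wotLimForm 𝒰 x c hx φ (a • ψ)
  simp only [map_smul, inner_smul_right] at h'
  exact tendsto_nhds_unique h' h

omit [CompleteSpace H] in
include hx in
/-- `wotLimForm` is additive in `φ`. [folklore] -/
theorem wotLimForm_add_left (φ₁ φ₂ ψ : H) :
    wotLimForm 𝒰 x (φ₁ + φ₂) ψ = wotLimForm 𝒰 x φ₁ ψ + wotLimForm 𝒰 x φ₂ ψ := by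
  have h := (tendsto_wotLimForm 𝒰 x c hx φ₁ ψ).add (tendsto_wotLimForm 𝒰 x c hx φ₂ ψ)
  have h' := tendsto_wotLimForm 𝒰 x c hx (φ₁ + φ₂) ψ
  simp only [inner_add_left] at h'
  exact tendsto_nhds_unique h' h

omit [CompleteSpace H] in
include hx in
/-- `wotLimForm` is conjugate-homogeneous in `φ`. [folklore] -/
theorem wotLimForm_smul_left (a : ℂ) (φ ψ : H) :
    wotLimForm 𝒰 x (a • φ) ψ = conj a * wotLimForm 𝒰 x φ ψ := by
  have h := (tendsto_wotLimForm 𝒰 x c hx φ ψ).const_mul (conj a)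
  have h' := tendsto_wotLimForm 𝒰 x c hx (a • φ) ψ
  simp only [inner_smul_left] at h'
  exact tendsto_nhds_unique h' h

omit [CompleteSpace H] in
include hx in
/-- `|wotLimForm φ ψ| ≤ c ‖φ‖ ‖ψ‖`. [folklore] -/
theorem norm_wotLimForm_le (φ ψ : H) : ‖wotLimForm 𝒰 x φ ψ‖ ≤ c * ‖φ‖ * ‖ψ‖ := by
  refine le_of_tendsto (tendsto_wotLimForm 𝒰 x c hx φ ψ).norm (Eventually.of_forall fun i => ?_)
  calc ‖⟪φ, x i ψ⟫_ℂ‖ ≤ ‖φ‖ * ‖x i ψ‖ := norm_inner_le_norm _ _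
    _ ≤ ‖φ‖ * (c * ‖ψ‖) := by
        gcongr
        exact (le_opNorm _ _).trans (by gcongr; exact hx i)
    _ = c * ‖φ‖ * ‖ψ‖ := by ring

/-- The functional `φ ↦ conj (wotLimForm φ ψ) = lim ⟪xᵢ ψ, φ⟫`, an element of the dual. [folklore] -/
def wotLimDual (ψ : H) : StrongDual ℂ H :=
  LinearMap.mkContinuous
    { toFun := fun φ => conj (wotLimForm 𝒰 x φ ψ)
      map_add' := fun φ₁ φ₂ => by
        change conj (wotLimForm 𝒰 x (φ₁ + φ₂) ψ) =
          conj (wotLimForm 𝒰 x φ₁ ψ) + conj (wotLimForm 𝒰 x φ₂ ψ)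
        rw [wotLimForm_add_left 𝒰 x c hx, map_add]
      map_smul' := fun a φ => by
        change conj (wotLimForm 𝒰 x (a • φ) ψ) = a * conj (wotLimForm 𝒰 x φ ψ)
        rw [wotLimForm_smul_left 𝒰 x c hx, map_mul, Complex.conj_conj] }
    (c * ‖ψ‖) fun φ => by
      simp only [LinearMap.coe_mk, AddHom.coe_mk, Complex.norm_conj]
      calc ‖wotLimForm 𝒰 x φ ψ‖ ≤ c * ‖φ‖ * ‖ψ‖ := norm_wotLimForm_le 𝒰 x c hx φ ψ
        _ = c * ‖ψ‖ * ‖φ‖ := by ring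

omit [CompleteSpace H] in
/-- Unfolding `wotLimDual`. [folklore] -/
theorem wotLimDual_apply (ψ φ : H) : wotLimDual 𝒰 x c hx ψ φ = conj (wotLimForm 𝒰 x φ ψ) := rfl

/-- **The weak-operator limit along an ultrafilter** of a bounded family of operators on a
Hilbert space (Riesz representation of the limit sesquilinear form). [folklore] -/
def ultraWOTLim : H →L[ℂ] H :=
  LinearMap.mkContinuous
    { toFun := fun ψ => (InnerProductSpace.toDual ℂ H).symm (wotLimDual 𝒰 x c hx ψ)
      map_add' := fun ψ₁ ψ₂ => by
        rw [← map_add]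
        congr 1
        ext φ
        rw [add_apply, wotLimDual_apply, wotLimDual_apply, wotLimDual_apply,
          wotLimForm_add_right 𝒰 x c hx, map_add]
      map_smul' := fun a ψ => by
        simp only [RingHom.id_apply]
        have hD : wotLimDual 𝒰 x c hx (a • ψ) = conj a • wotLimDual 𝒰 x c hx ψ := by
          ext φ
          rw [smul_apply, wotLimDual_apply, wotLimDual_apply, smul_eq_mul,
            wotLimForm_smul_right 𝒰 x c hx, map_mul]
        rw [hD, LinearIsometryEquiv.map_smulₛₗ, starRingEnd_self_apply] }
    c fun ψ => by
      simp only [LinearMap.coe_mk, AddHom.coe_mk, LinearIsometryEquiv.norm_map]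
      exact LinearMap.mkContinuous_norm_le _
        (mul_nonneg (nonneg_of_norm_bound 𝒰 hx) (norm_nonneg _)) _

/-- **Defining property**: `⟪φ, (ultraWOTLim) ψ⟫ = lim_𝒰 ⟪φ, xᵢ ψ⟫`. [folklore] -/
theorem inner_ultraWOTLim (φ ψ : H) :
    ⟪φ, ultraWOTLim 𝒰 x c hx ψ⟫_ℂ = wotLimForm 𝒰 x φ ψ := by
  change ⟪φ, (InnerProductSpace.toDual ℂ H).symm (wotLimDual 𝒰 x c hx ψ)⟫_ℂ = _
  rw [← inner_conj_symm, InnerProductSpace.toDual_symm_apply, wotLimDual_apply, Complex.conj_conj]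

/-- `⟪φ, xᵢ ψ⟫ → ⟪φ, (ultraWOTLim) ψ⟫` along `𝒰`. [folklore] -/
theorem tendsto_inner_ultraWOTLim (φ ψ : H) :
    Tendsto (fun i => ⟪φ, x i ψ⟫_ℂ) 𝒰 (𝓝 ⟪φ, ultraWOTLim 𝒰 x c hx ψ⟫_ℂ) := by
  rw [inner_ultraWOTLim]
  exact tendsto_wotLimForm 𝒰 x c hx φ ψ

/-- **Norm bound** `‖ultraWOTLim‖ ≤ c`. [folklore] -/
theorem norm_ultraWOTLim_le : ‖ultraWOTLim 𝒰 x c hx‖ ≤ c :=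
  LinearMap.mkContinuous_norm_le _ (nonneg_of_norm_bound 𝒰 hx) _

/-- **Weak-operator limits of elements of `M` stay in `M`.** [cite: RieffelVandaele1977, Lemma 4.3 (proof)] -/
theorem ultraWOTLim_mem (M : VonNeumannAlgebra H) (hM : ∀ i, x i ∈ M) :
    ultraWOTLim 𝒰 x c hx ∈ M :=
  VonNeumannAlgebra.mem_of_weak_tendsto M hM (tendsto_inner_ultraWOTLim 𝒰 x c hx)

/-- **Self-adjointness is preserved** under weak-operator limits. [folklore] -/
theorem ultraWOTLim_isSelfAdjoint (hsa : ∀ i, IsSelfAdjoint (x i)) :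
    IsSelfAdjoint (ultraWOTLim 𝒰 x c hx) := by
  rw [ContinuousLinearMap.isSelfAdjoint_iff_isSymmetric]
  intro φ ψ
  change ⟪ultraWOTLim 𝒰 x c hx φ, ψ⟫_ℂ = ⟪φ, ultraWOTLim 𝒰 x c hx ψ⟫_ℂ
  have h1 := tendsto_inner_ultraWOTLim 𝒰 x c hx φ ψ
  have h2 := tendsto_inner_ultraWOTLim 𝒰 x c hx ψ φ
  have h2' : Tendsto (fun i => conj ⟪ψ, x i φ⟫_ℂ) 𝒰 (𝓝 (conj ⟪ψ, ultraWOTLim 𝒰 x c hx φ⟫_ℂ)) :=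
    (Complex.continuous_conj.tendsto _).comp h2
  simp only [inner_conj_symm] at h2'
  have heq : (fun i => ⟪x i φ, ψ⟫_ℂ) = fun i => ⟪φ, x i ψ⟫_ℂ := by
    ext i
    have hsym := ContinuousLinearMap.isSelfAdjoint_iff_isSymmetric.1 (hsa i)
    simpa only [ContinuousLinearMap.coe_coe] using hsym φ ψ
  rw [heq] at h2'
  exact (tendsto_nhds_unique h2' h1)

/-- **Strong convergence on a vector passes to the limit**: if `xᵢ ψ → v` along `𝒰` then
`(ultraWOTLim) ψ = v`. [folklore] -/
theorem ultraWOTLim_apply_eq_of_tendsto {ψ v : H} (h : Tendsto (fun i => x i ψ) 𝒰 (𝓝 v)) :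
    ultraWOTLim 𝒰 x c hx ψ = v := by
  refine ext_inner_left ℂ fun φ => ?_
  have h1 := tendsto_inner_ultraWOTLim 𝒰 x c hx φ ψ
  have h2 : Tendsto (fun i => ⟪φ, x i ψ⟫_ℂ) 𝒰 (𝓝 ⟪φ, v⟫_ℂ) :=
    ((continuous_const.inner continuous_id).tendsto _).comp h
  exact tendsto_nhds_unique h1 h2

/-- Positivity of all `Re ⟪xᵢ ψ, ψ⟫` passes to the limit. [folklore] -/
theorem re_inner_ultraWOTLim_nonneg (hpos : ∀ i (ψ : H), 0 ≤ (⟪ψ, x i ψ⟫_ℂ).re) (ψ : H) :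
    0 ≤ (⟪ψ, ultraWOTLim 𝒰 x c hx ψ⟫_ℂ).re := by
  have h1 := (Complex.continuous_re.tendsto _).comp (tendsto_inner_ultraWOTLim 𝒰 x c hx ψ ψ)
  exact ge_of_tendsto h1 (Eventually.of_forall fun i => hpos i ψ)

end Ultra

end Literature.Analysis.OperatorTheory
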